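import Summits.HubbardSuperconductivity.HubbardSuperconductivity.Theorems.AnisotropyChordChordXYFourFar
import Summits.HubbardSuperconductivity.HubbardSuperconductivity.Theorems.AnisotropyChordTowerSectorSpace

/-!
# Route `AnisotropyChord` / crux `ChordXY` at `M = 4`: toolkit for the perturbative (touching-point) certificate
# (prover seat `hubbard-h0-rotor-p1` g18)

Scalar lemmas: `gap_of_rankOne` (elementary interlacing: a rank-one-shifted PSD certificate on `span(a₀, w)` gives the gap for
`w ⊥ a₀`), `cross_sq_le` (`2 × 2` compression bound `x² ≤ Λ₀(T − Λ₀)·n`).  Linear algebra of real amplitudes: `fmOp_lin`,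
`lowerSum_lin`, `energy_lin` (expansion of `Σ b(Ab + Wb)` with the symmetric cross term), `lowerNormSq_lin`, `diag_lin`;
`two_brokenOrd_le`, `isingW_ge_neg_eight` (`W ≥ −8` on the `4 × 4` torus); `e8_zero_le` (`E₀(0) + 8 ≤ −99/100` from `rr_zero`).
-/

set_option linter.style.longLine false
set_option linter.dupNamespace false
set_option autoImplicit false

open Finset
open Literature.MathematicalPhysics.QuantumLattice Literature.Probability.LatticeModels
open Summit.HubbardSuperconductivity.HubbardSuperconductivity.Theorems.AnisotropyChord.Tower
open Summit.HubbardSuperconductivity.HubbardSuperconductivity.Theorems.AnisotropyChord.InsertionEntropy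

namespace Summit.HubbardSuperconductivity.HubbardSuperconductivity.Theorems.AnisotropyChord.FourTorus

/-! ## Scalar lemmas -/

/-- **elementary interlacing:** if the rank-one-shifted form is non-negative on `span(a₀, w)` (`w ⊥ a₀`, cross term zero) and
the ground value `e` lies below the threshold `θ`, then `R = 𝓔(w) ≥ θ·‖w‖²`. [folklore] -/
theorem gap_of_rankOne {e θ R n t u₀ u₁ : ℝ} (he : e < θ)
    (hQ : ∀ α β : ℝ, 0 ≤ α ^ 2 * (e - θ) + β ^ 2 * (R - θ * n) + t * (α * u₀ + β * u₁) ^ 2) : θ * n ≤ R := by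
  have h1 := hQ u₁ (-u₀)
  have h2 : 0 ≤ (e - θ) + t * u₀ ^ 2 := by linarith [hQ 1 0]
  have hx : (u₁ * u₀ + -u₀ * u₁) = 0 := by ring
  rw [hx] at h1
  -- `u₀ ≠ 0`
  have hu0 : 0 < u₀ ^ 2 := by
    rcases eq_or_ne u₀ 0 with h0 | h0
    · subst h0; norm_num at h2; linarith
    · positivity
  by_contra H
  push Not at H
  have : u₀ ^ 2 * (R - θ * n) < 0 := mul_neg_of_pos_of_neg hu0 (by linarith)
  nlinarith [sq_nonneg u₁, h1]

/-- **`2 × 2` compression bound:** `0 ⪯ [[Λ₀, x],[x, Λw]] ⪯ T·[[1,0],[0,n]]` and `0 < Λ₀ < T` give `x² ≤ Λ₀(T − Λ₀)·n`. [folklore] -/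
theorem cross_sq_le {Λ₀ Λw x T n : ℝ} (hL0 : 0 < Λ₀) (hLT : Λ₀ < T)
    (h0 : ∀ α β : ℝ, 0 ≤ α ^ 2 * Λ₀ + 2 * α * β * x + β ^ 2 * Λw)
    (hT : ∀ α β : ℝ, α ^ 2 * Λ₀ + 2 * α * β * x + β ^ 2 * Λw ≤ T * (α ^ 2 + β ^ 2 * n)) :
    x ^ 2 ≤ Λ₀ * (T - Λ₀) * n := by
  have hA : 0 ≤ Λ₀ * Λw - x ^ 2 := by
    have h := h0 x (-Λ₀)
    have e : x ^ 2 * Λ₀ + 2 * x * -Λ₀ * x + (-Λ₀) ^ 2 * Λw = Λ₀ * (Λ₀ * Λw - x ^ 2) := by ring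
    rw [e] at h
    by_contra H
    push Not at H
    have := mul_neg_of_pos_of_neg hL0 H
    linarith
  have hB : 0 ≤ (T - Λ₀) * (T * n - Λw) - x ^ 2 := by
    have h := hT x (T - Λ₀)
    have e : T * (x ^ 2 + (T - Λ₀) ^ 2 * n) - (x ^ 2 * Λ₀ + 2 * x * (T - Λ₀) * x + (T - Λ₀) ^ 2 * Λw)
        = (T - Λ₀) * ((T - Λ₀) * (T * n - Λw) - x ^ 2) := by ring
    have h' : 0 ≤ (T - Λ₀) * ((T - Λ₀) * (T * n - Λw) - x ^ 2) := by rw [← e]; linarith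
    have hpos : 0 < T - Λ₀ := by linarith
    nlinarith
  have key : T * (Λ₀ * (T - Λ₀) * n - x ^ 2) = (T - Λ₀) * (Λ₀ * Λw - x ^ 2) + Λ₀ * ((T - Λ₀) * (T * n - Λw) - x ^ 2) := by ring
  have hsum : 0 ≤ T * (Λ₀ * (T - Λ₀) * n - x ^ 2) := by
    rw [key]; exact add_nonneg (mul_nonneg (by linarith) hA) (mul_nonneg hL0.le hB)
  have hTpos : 0 < T := by linarith
  nlinarith

/-! ## Linear algebra of real amplitudes -/

section Forms
variable {V : Type} [Fintype V] [DecidableEq V] (G : SimpleGraph V) [DecidableRel G.Adj]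

/-- `fmOp` is linear. [folklore] -/
theorem fmOp_lin (α β : ℝ) (a b : (V → Fin 2) → ℝ) :
    fmOp G (fun σ => α * a σ + β * b σ) = fun σ => α * fmOp G a σ + β * fmOp G b σ := by
  have e : (fun σ => α * a σ + β * b σ) = α • a + β • b := by funext σ; simp [Pi.add_apply, Pi.smul_apply, smul_eq_mul]
  rw [e, fmOp_add', fmOp_smul', fmOp_smul']
  funext σ; simp [Pi.add_apply, Pi.smul_apply, smul_eq_mul]

/-- `lowerSum` is linear. [folklore] -/
theorem lowerSum_lin (α β : ℝ) (a b : (V → Fin 2) → ℝ) (τ : V → Fin 2) :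
    lowerSum (fun σ => α * a σ + β * b σ) τ = α * lowerSum a τ + β * lowerSum b τ := by
  unfold lowerSum
  rw [Finset.mul_sum, Finset.mul_sum, ← Finset.sum_add_distrib]
  refine Finset.sum_congr rfl fun x _ => ?_
  split_ifs <;> ring

/-- the energy form `𝓔(b) = Σ b·(A b + W b)` at `Δ = 0` expands on `α a + β b` with the symmetric cross term. [folklore] -/
theorem energy_lin (α β : ℝ) (a b : (V → Fin 2) → ℝ) :
    ∑ σ, (α * a σ + β * b σ) * (fmOp G (fun σ => α * a σ + β * b σ) σ + isingW G σ * (α * a σ + β * b σ))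
      = α ^ 2 * ∑ σ, a σ * (fmOp G a σ + isingW G σ * a σ)
        + 2 * α * β * ∑ σ, b σ * (fmOp G a σ + isingW G σ * a σ)
        + β ^ 2 * ∑ σ, b σ * (fmOp G b σ + isingW G σ * b σ) := by
  rw [fmOp_lin]
  have hsym : ∑ σ, a σ * fmOp G b σ = ∑ σ, b σ * fmOp G a σ := by
    rw [sum_mul_fmOp_comm]; exact Finset.sum_congr rfl fun σ _ => by ring
  have e : ∀ σ, (α * a σ + β * b σ) * ((α * fmOp G a σ + β * fmOp G b σ) + isingW G σ * (α * a σ + β * b σ))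
      = α ^ 2 * (a σ * (fmOp G a σ + isingW G σ * a σ)) + α * β * (b σ * (fmOp G a σ + isingW G σ * a σ))
        + α * β * (a σ * fmOp G b σ + isingW G σ * a σ * b σ) + β ^ 2 * (b σ * (fmOp G b σ + isingW G σ * b σ)) := by
    intro σ; ring
  simp only [e, Finset.sum_add_distrib, ← Finset.mul_sum]
  have h2 : (∑ σ, a σ * fmOp G b σ) + ∑ σ, isingW G σ * a σ * b σ = ∑ σ, b σ * (fmOp G a σ + isingW G σ * a σ) := by
    rw [hsym, ← Finset.sum_add_distrib]
    exact Finset.sum_congr rfl fun σ _ => by ring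
  rw [h2]; ring

/-- `‖S⁻(α a + β b)‖²` expands with the cross term `Σ_τ (S⁻a)(τ)(S⁻b)(τ)`. [folklore] -/
theorem lowerNormSq_lin (α β : ℝ) (a b : (V → Fin 2) → ℝ) :
    lowerNormSq (fun σ => α * a σ + β * b σ)
      = α ^ 2 * lowerNormSq a + 2 * α * β * (∑ τ, lowerSum a τ * lowerSum b τ) + β ^ 2 * lowerNormSq b := by
  unfold lowerNormSq
  simp_rw [lowerSum_lin]
  have e : ∀ τ, (α * lowerSum a τ + β * lowerSum b τ) ^ 2
      = α ^ 2 * lowerSum a τ ^ 2 + 2 * α * β * (lowerSum a τ * lowerSum b τ) + β ^ 2 * lowerSum b τ ^ 2 := by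
    intro τ; ring
  simp only [e, Finset.sum_add_distrib, ← Finset.mul_sum]

/-- a diagonal form expands on `α a + β b`. [folklore] -/
theorem diag_lin (D : (V → Fin 2) → ℝ) (α β : ℝ) (a b : (V → Fin 2) → ℝ) :
    ∑ σ, D σ * (α * a σ + β * b σ) ^ 2
      = α ^ 2 * ∑ σ, D σ * a σ ^ 2 + 2 * α * β * ∑ σ, D σ * a σ * b σ + β ^ 2 * ∑ σ, D σ * b σ ^ 2 := by
  have e : ∀ σ, D σ * (α * a σ + β * b σ) ^ 2
      = α ^ 2 * (D σ * a σ ^ 2) + 2 * α * β * (D σ * a σ * b σ) + β ^ 2 * (D σ * b σ ^ 2) := by intro σ; ring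
  simp only [e, Finset.sum_add_distrib, ← Finset.mul_sum]

/-- on a graph with `Σ_x Σ_y [x ∼ y] = D`, `brokenOrd σ ≤ D/2` (the two ordered broken counts agree and sum to at most `D`). [folklore] -/
theorem two_brokenOrd_le (σ : V → Fin 2) :
    2 * brokenOrd G σ ≤ ∑ x, ∑ y, if G.Adj x y then (1:ℝ) else 0 := by
  have h := brokenOrd'_eq G σ
  rw [two_mul]
  nth_rewrite 1 [← h]
  unfold brokenOrd brokenOrd'
  rw [← Finset.sum_add_distrib]
  refine Finset.sum_le_sum fun x _ => ?_
  rw [← Finset.sum_add_distrib]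
  refine Finset.sum_le_sum fun y _ => ?_
  by_cases h1 : G.Adj x y <;> by_cases h2 : σ x = 1 <;> by_cases h3 : σ y = 0 <;> by_cases h4 : σ x = 0 <;> by_cases h5 : σ y = 1 <;>
    simp_all

end Forms

/-- on the `4 × 4` torus the Ising diagonal is `≥ −8`. [folklore] -/
theorem isingW_ge_neg_eight (σ : Cfg) : -8 ≤ isingW (torusGraph 2 4) σ := by
  rw [isingW_four]
  have h := two_brokenOrd_le (torusGraph 2 4) σ
  rw [torus4_degree_sum] at h
  linarith

/-- `g ≥ 289/100`: the certified gap `19/10 − R̃₀` below the symmetric-sector spectrum above the ground state. [folklore] -/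
theorem e8_zero_le : lowestEnergyInSector 1 (xxzHamiltonian 1 (torusGraph 2 4) (-1) 0) 0 + 8 ≤ -99/100 := by
  have h := rr_zero
  rw [nac_val, eac_val] at h
  push_cast at h
  nlinarith [h]


end Summit.HubbardSuperconductivity.HubbardSuperconductivity.Theorems.AnisotropyChord.FourTorus
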